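import Mathlib.Combinatorics.SimpleGraph.Finite
import Mathlib.Data.Fin.VecNotation
import Literature.Computability.Complexity.ACRealizeVec
import Literature.Computability.Complexity.ACRealizeConnectives
import Literature.Computability.Complexity.CliqueTestGraphs
import Literature.Computability.Complexity.PolylogThreshold
import Literature.Combinatorics.SimpleGraph.VertexCoverKernel
import Literature.Barriers.PneNP.Locality
import HarnessLib

/-!
# The kernelization circuit for `(n-k)`-Clique (towards `Locality_holds`)

The `AC⁰` part of the oracle circuit of Chen–Hirahara–Oliveira–Pich–Rajgopal–Santhanam,
Prop. 50 (E1^𝒪) [arXiv191108297, p. 27; Appendix, Prop. 63]: on the `n choose 2` edge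
indicators `x` of a graph `G_x` on `Fin n` it computes, in constant depth and size
`n² · (polylog-threshold gadget)`, the **kernel bits**

* `[i + 1 ≤ |high|]` for `i ≤ k` (unary count of the high vertices, capped at `k + 1`),
* `[2k² + 1 ≤ |ker|]` (too many kernel vertices),
* the adjacency matrix `kerAdj G_x k (2k²+1)` of the kernel graph on `Fin (2k²+1)`,

of Buss' kernel (`Literature.Combinatorics.SimpleGraph.VertexCoverKernel`), which determine
`cliqueFn n (n-k) x` (`not_cliqueFree_iff_kernel`). The circuit is four layers composed WITH
SHARING (`ACVec.comp`): negated edge literals; the high-vertex indicators (`n` threshold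
gadgets `acReal_threshold`); the capped count of high vertices, the kernel-vertex indicators;
the kernel-vertex count and the rank thresholds `[i ≤ rank v]`; and finally the kernel
adjacency bits (an `∨` over pairs of an `∧` of seven literals). This file has the index
types, the intended values `val1`–`val3`, `kernelBits` (over the tree's `cliqueGraph x`, the
graph inside `cliqueFn`), and the four layers as circuits (`acVec_layer1`–`acVec_layer4`,
sizes `gadgetSize`, `kernelSize`). Forthcoming companions: `LocalityKernel.lean` (semantics of
the layers and the composed circuit
`acVec_kernelBits : ACVec (kernelBits k) (6r + 10) (kernelSize n k b r)`) and
`LocalityE1Proofs.lean` (the oracle gate, the oracle language and `Locality_holds`), whose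
size/fan-in estimates go through `LocalityAsymptotics.lean` (`le_ceil_choose_two_rpow`,
`floor_logb_pow_le`). (`LocalityProofs.lean` is the discharge of the companion fact E3^𝒪.)

## References

* [arXiv191108297] L. Chen, S. Hirahara, I. C. Oliveira, J. Pich, N. Rajgopal, R. Santhanam,
  *Beyond natural proofs: hardness magnification and locality*, Prop. 50 and its proof (p. 27),
  Appendix A, Prop. 63 (p. 37): "the circuit … simulates a well-known kernelization algorithm
  for `k`-Vertex-Cover … `H` containing `O(k²)` vertices … described by a string of length
  `O(k⁴)` … the input string to the single oracle gate".
* I. C. Oliveira, R. Santhanam, *Hardness magnification for natural problems*, FOCS 2018.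
-/

noncomputable section

open Classical Finset
open Literature.Computability.Complexity Literature.Combinatorics.SimpleGraph

namespace Literature.Barriers.PneNP.Locality

variable {n : ℕ}

/-! ### Inputs: edge positions and the graph of an input -/

/-- The input position of the pair `{u, v}`, `u ≠ v` (an edge of `K_n`). [folklore] -/
def edge (u v : Fin n) (h : u ≠ v) : (⊤ : SimpleGraph (Fin n)).edgeSet :=
  ⟨s(u, v), by rw [SimpleGraph.mem_edgeSet, SimpleGraph.top_adj]; exact h⟩

/-- Adjacency in `cliqueGraph x` (the graph spanned by the true inputs, the graph inside
`cliqueFn`; `CliqueTestGraphs.lean`) is the input bit of the edge. [folklore] -/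
theorem cliqueGraph_adj_edge {x : (⊤ : SimpleGraph (Fin n)).edgeSet → Bool} {u v : Fin n}
    (h : u ≠ v) : (cliqueGraph x).Adj u v ↔ x (edge u v h) = true := by
  rw [cliqueGraph_adj]
  exact ⟨fun ⟨_, hx⟩ => hx, fun hx => ⟨h, hx⟩⟩

/-- `edge` is symmetric. [folklore] -/
theorem edge_comm (u v : Fin n) (h : u ≠ v) : edge u v h = edge v u h.symm :=
  Subtype.ext (Sym2.eq_swap)

/-! ### Index types of the layers and the intended values -/

variable (n) in
/-- Outputs of layer 1: `[v ∈ high]` for each vertex, and the negated edge literals. [folklore] -/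
abbrev K1 : Type := Fin n ⊕ (⊤ : SimpleGraph (Fin n)).edgeSet

variable (n) in
/-- Outputs of layer 2: `[i+1 ≤ |high|]` (`i ≤ k`), `[v ∈ ker]`, negated edge literals.
[folklore] -/
abbrev K2 (k : ℕ) : Type := Fin (k + 1) ⊕ Fin n ⊕ (⊤ : SimpleGraph (Fin n)).edgeSet

variable (n) in
/-- Outputs of layer 3: `[2k²+1 ≤ |ker|]`, the rank thresholds `[i ≤ rank v]` (`i ≤ 2k²+1`),
and everything of layer 2. [folklore] -/
abbrev K3 (k : ℕ) : Type := Unit ⊕ (Fin n × Fin (2 * k ^ 2 + 2)) ⊕ K2 n k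

/-- The kernel bits (inputs of the oracle gate): unary count of high vertices, overflow bit of
the kernel, kernel adjacency matrix on `Fin (2k²+1)`. [cite: arXiv191108297, Prop. 50] -/
abbrev KB (k : ℕ) : Type := Fin (k + 1) ⊕ Unit ⊕ (Fin (2 * k ^ 2 + 1) × Fin (2 * k ^ 2 + 1))

/-- Intended values of layer 1. [folklore] -/
def val1 (k : ℕ) (x : (⊤ : SimpleGraph (Fin n)).edgeSet → Bool) : K1 n → Bool
  | .inl v => decide (v ∈ high (cliqueGraph x) k)
  | .inr e => !x e

/-- Intended values of layer 2. [folklore] -/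
def val2 (k : ℕ) (x : (⊤ : SimpleGraph (Fin n)).edgeSet → Bool) : K2 n k → Bool
  | .inl i => decide (i.1 + 1 ≤ (high (cliqueGraph x) k).card)
  | .inr (.inl v) => decide (v ∈ ker (cliqueGraph x) k)
  | .inr (.inr e) => !x e

/-- Intended values of layer 3. [folklore] -/
def val3 (k : ℕ) (x : (⊤ : SimpleGraph (Fin n)).edgeSet → Bool) : K3 n k → Bool
  | .inl _ => decide (2 * k ^ 2 + 1 ≤ (ker (cliqueGraph x) k).card)
  | .inr (.inl p) => decide (p.2.1 ≤ rank (cliqueGraph x) k p.1)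
  | .inr (.inr κ) => val2 k x κ

/-- **The kernel bits** of the input graph (what the oracle gate reads).
[cite: arXiv191108297, Prop. 50] -/
def kernelBits (k : ℕ) (x : (⊤ : SimpleGraph (Fin n)).edgeSet → Bool) : KB k → Bool
  | .inl i => decide (i.1 + 1 ≤ (high (cliqueGraph x) k).card)
  | .inr (.inl _) => decide (2 * k ^ 2 + 1 ≤ (ker (cliqueGraph x) k).card)
  | .inr (.inr p) => decide (kerAdj (cliqueGraph x) k (2 * k ^ 2 + 1) p.1 p.2)

/-! ### The layers as circuits -/

/-- The size of one threshold gadget over at most `n` literals with cap `2k²+1` and tree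
parameters `b`, `r` (`acReal_threshold`). [folklore] -/
def gadgetSize (n k b r : ℕ) : ℕ := (n + 1) * ((2 * k ^ 2 + 2) ^ b * (b + 1) + 1) ^ r + 1

/-- A threshold gadget over a sub-family of at most `n` literals, with the uniform size bound.
[folklore] -/
theorem acReal_threshold_le {κ α : Type*} [Fintype α] (sel : α → κ) {k b r : ℕ}
    (hα : Fintype.card α ≤ n) (hbr : 2 * (2 * k ^ 2 + 1) ^ 2 < b ^ r) (j : ℕ)
    (hj : j ≤ 2 * k ^ 2 + 1) :
    ACReal (fun y : κ → Bool => decide (j ≤ (univ.filter fun a => y (sel a) = true).card))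
      (2 * r + 2) (gadgetSize n k b r) := by
  refine (acReal_threshold sel hbr j hj).mono le_rfl ?_
  unfold gadgetSize
  gcongr

/-- **Layer 0 → 1.** From the negated edge literals `y e = ¬x e`: the high-vertex indicators
`[k+1 ≤ #{u ≠ v | y {u,v}}]` (one threshold gadget per vertex) and the literals themselves.
[folklore] -/
theorem acVec_layer1 (k b r : ℕ) (hbr : 2 * (2 * k ^ 2 + 1) ^ 2 < b ^ r) :
    ACVec (ι := (⊤ : SimpleGraph (Fin n)).edgeSet) (κ := K1 n)
      (fun y κ => match κ with
        | .inl v => decide (k + 1 ≤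
            (univ.filter fun u : {u // u ≠ v} => y (edge u.1 v u.2) = true).card)
        | .inr e => y e)
      (2 * r + 2) (n * gadgetSize n k b r) := by
  have h := acVec_ofBlocks_fintype (ι := (⊤ : SimpleGraph (Fin n)).edgeSet) (κ := K1 n)
    (f := fun κ y => match κ with
        | .inl v => decide (k + 1 ≤
            (univ.filter fun u : {u // u ≠ v} => y (edge u.1 v u.2) = true).card)
        | .inr e => y e)
    (d := 2 * r + 2) (s := Sum.elim (fun _ => gadgetSize n k b r) (fun _ => 0)) ?_
  · refine h.mono le_rfl (le_of_eq ?_)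
    simp [Fintype.sum_sum_type]
  · rintro (v | e)
    · exact acReal_threshold_le _ (by simp [Fintype.card_subtype_compl]) hbr _ (by nlinarith)
    · exact (acReal_input e).mono (Nat.zero_le _) le_rfl

/-- **Layer 1 → 2.** The capped unary count of the high vertices (`k + 1` gadgets), the
kernel-vertex indicators `¬hi v ∧ ∃ u ≠ v, ¬hi u ∧ ¬x{u,v}` (depth-3 formulas), pass-through.
[folklore] -/
theorem acVec_layer2 (k b r : ℕ) (hbr : 2 * (2 * k ^ 2 + 1) ^ 2 < b ^ r) (hr : 1 ≤ r) :
    ACVec (ι := K1 n) (κ := K2 n k)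
      (fun y κ => match κ with
        | .inl i => decide (i.1 + 1 ≤ (univ.filter fun v : Fin n => y (.inl v) = true).card)
        | .inr (.inl v) => !y (.inl v) &&
            decide (∃ u : {u // u ≠ v}, (!y (.inl u.1) && y (.inr (edge u.1 v u.2))) = true)
        | .inr (.inr e) => y (.inr e))
      (2 * r + 2) ((k + 1) * gadgetSize n k b r + n * (2 * n + 4)) := by
  have h := acVec_ofBlocks_fintype (ι := K1 n) (κ := K2 n k)
    (f := fun κ y => match κ with
        | .inl i => decide (i.1 + 1 ≤ (univ.filter fun v : Fin n => y (.inl v) = true).card)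
        | .inr (.inl v) => !y (.inl v) &&
            decide (∃ u : {u // u ≠ v}, (!y (.inl u.1) && y (.inr (edge u.1 v u.2))) = true)
        | .inr (.inr e) => y (.inr e))
    (d := 2 * r + 2)
    (s := Sum.elim (fun _ => gadgetSize n k b r) (Sum.elim (fun _ => 2 * n + 4) (fun _ => 0))) ?_
  · refine h.mono le_rfl (le_of_eq ?_)
    simp [Fintype.sum_sum_type]
  · rintro (i | v | e)
    · exact acReal_threshold_le _ (by simp) hbr _ (by have := i.2; nlinarith)
    · -- `¬hi v ∧ ∃ u ≠ v, ¬hi u ∧ y {u,v}`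
      have hlit : ∀ u : {u // u ≠ v},
          ACReal (fun y : K1 n → Bool => !y (.inl u.1) && y (.inr (edge u.1 v u.2))) 1 2 :=
        fun u => acReal_and (acReal_notInput (Sum.inl u.1))
          (acReal_input (ι := K1 n) (Sum.inr (edge u.1 v u.2)))
      have hex := acReal_exists_fintype hlit
      have hand := acReal_and
        ((acReal_notInput (ι := K1 n) (Sum.inl v)).mono (Nat.zero_le 2) le_rfl) hex
      refine (hand.mono (by omega) ?_).congr fun y => rfl
      have hc : Fintype.card {u // u ≠ v} ≤ n :=
        (Fintype.card_subtype_le (fun u : Fin n => u ≠ v)).trans (by simp)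
      show 1 + (Fintype.card {u // u ≠ v} * 2 + 1) + 1 ≤ 2 * n + 4
      omega
    · exact (acReal_input _).mono (Nat.zero_le _) le_rfl

/-- **Layer 2 → 3.** The overflow bit `[2k²+1 ≤ #ker]`, the rank thresholds
`[i ≤ #{u < v | u ∈ ker}]` (`n (2k²+2)` gadgets), pass-through. [folklore] -/
theorem acVec_layer3 (k b r : ℕ) (hbr : 2 * (2 * k ^ 2 + 1) ^ 2 < b ^ r) :
    ACVec (ι := K2 n k) (κ := K3 n k)
      (fun y κ => match κ with
        | .inl _ => decide (2 * k ^ 2 + 1 ≤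
            (univ.filter fun v : Fin n => y (.inr (.inl v)) = true).card)
        | .inr (.inl p) => decide (p.2.1 ≤
            (univ.filter fun u : {u // u < p.1} => y (.inr (.inl u.1)) = true).card)
        | .inr (.inr κ') => y κ')
      (2 * r + 2) ((1 + n * (2 * k ^ 2 + 2)) * gadgetSize n k b r) := by
  have h := acVec_ofBlocks_fintype (ι := K2 n k) (κ := K3 n k)
    (f := fun κ y => match κ with
        | .inl _ => decide (2 * k ^ 2 + 1 ≤
            (univ.filter fun v : Fin n => y (.inr (.inl v)) = true).card)
        | .inr (.inl p) => decide (p.2.1 ≤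
            (univ.filter fun u : {u // u < p.1} => y (.inr (.inl u.1)) = true).card)
        | .inr (.inr κ') => y κ')
    (d := 2 * r + 2)
    (s := Sum.elim (fun _ => gadgetSize n k b r)
      (Sum.elim (fun _ => gadgetSize n k b r) (fun _ => 0))) ?_
  · refine h.mono le_rfl (le_of_eq ?_)
    simp [Fintype.sum_sum_type]
    ring
  · rintro (u | p | κ')
    · exact acReal_threshold_le _ (by simp) hbr _ le_rfl
    · exact acReal_threshold_le _ ((Fintype.card_subtype_le _).trans (by simp)) hbr _
        (by have := p.2.2; omega)
    · exact (acReal_input _).mono (Nat.zero_le _) le_rfl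

/-- The seven literals of a kernel-adjacency witness `(u, v)` for the slot `(i, j)`:
`u, v ∈ ker`, `rank u = i`, `rank v = j` (as threshold bits), `¬x{u,v}`. [folklore] -/
def adjLits (k : ℕ) (i j : Fin (2 * k ^ 2 + 1)) (p : {p : Fin n × Fin n // p.1 ≠ p.2})
    (y : K3 n k → Bool) : Bool :=
  y (.inr (.inr (.inr (.inl p.1.1)))) && y (.inr (.inr (.inr (.inl p.1.2)))) &&
    (y (.inr (.inl (p.1.1, ⟨i, by omega⟩))) && !y (.inr (.inl (p.1.1, ⟨i + 1, by omega⟩)))) &&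
    (y (.inr (.inl (p.1.2, ⟨j, by omega⟩))) && !y (.inr (.inl (p.1.2, ⟨j + 1, by omega⟩)))) &&
    y (.inr (.inr (.inr (.inr (edge p.1.1 p.1.2 p.2)))))

/-- The witness conjunction is a depth-`3` formula with at most `13` gates. [folklore] -/
theorem acReal_adjLits (k : ℕ) (i j : Fin (2 * k ^ 2 + 1)) (p : {p : Fin n × Fin n // p.1 ≠ p.2}) :
    ACReal (adjLits k i j p) 3 13 := by
  unfold adjLits
  have l1 := acReal_input (ι := K3 n k) (.inr (.inr (.inr (.inl p.1.1))))
  have l2 := acReal_input (ι := K3 n k) (.inr (.inr (.inr (.inl p.1.2))))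
  have l3 := acReal_input (ι := K3 n k) (.inr (.inl (p.1.1, ⟨i, by omega⟩)))
  have l4 := acReal_notInput (ι := K3 n k) (.inr (.inl (p.1.1, ⟨i + 1, by omega⟩)))
  have l5 := acReal_input (ι := K3 n k) (.inr (.inl (p.1.2, ⟨j, by omega⟩)))
  have l6 := acReal_notInput (ι := K3 n k) (.inr (.inl (p.1.2, ⟨j + 1, by omega⟩)))
  have l7 := acReal_input (ι := K3 n k) (.inr (.inr (.inr (.inr (edge p.1.1 p.1.2 p.2)))))
  have a12 := acReal_and l1 l2
  have a34 := acReal_and (l3.mono le_rfl (Nat.zero_le 1)) l4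
  have a56 := acReal_and (l5.mono le_rfl (Nat.zero_le 1)) l6
  have b1 := acReal_and a12 a34
  have b2 := acReal_and a56 (l7.mono (Nat.zero_le 1) (Nat.zero_le 0))
  have c := acReal_and b1 b2
  exact (c.mono le_rfl (by norm_num)).congr fun y => by simp only [Bool.and_assoc]

/-- **Layer 3 → kernel bits.** The kernel adjacency bit of the slot `(i, j)` is the `∨` over
pairs `u ≠ v` of the witness conjunction; the count bits are passed through. [folklore] -/
theorem acVec_layer4 (k : ℕ) :
    ACVec (ι := K3 n k) (κ := KB k)
      (fun y κ => match κ with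
        | .inl i => y (.inr (.inr (.inl i)))
        | .inr (.inl _) => y (.inl ())
        | .inr (.inr q) =>
            decide (∃ p : {p : Fin n × Fin n // p.1 ≠ p.2}, adjLits k q.1 q.2 p y = true))
      4 ((2 * k ^ 2 + 1) ^ 2 * (13 * n ^ 2 + 1)) := by
  have h := acVec_ofBlocks_fintype (ι := K3 n k) (κ := KB k)
    (f := fun κ y => match κ with
        | .inl i => y (.inr (.inr (.inl i)))
        | .inr (.inl _) => y (.inl ())
        | .inr (.inr q) =>
            decide (∃ p : {p : Fin n × Fin n // p.1 ≠ p.2}, adjLits k q.1 q.2 p y = true))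
    (d := 4) (s := Sum.elim (fun _ => 0) (Sum.elim (fun _ => 0) (fun _ => 13 * n ^ 2 + 1))) ?_
  · refine h.mono le_rfl (le_of_eq ?_)
    simp [Fintype.sum_sum_type, sq]
  · rintro (i | u | q)
    · exact (acReal_input _).mono (Nat.zero_le _) le_rfl
    · exact (acReal_input _).mono (Nat.zero_le _) le_rfl
    · refine ((acReal_exists_fintype fun p => acReal_adjLits k q.1 q.2 p).mono le_rfl ?_).congr
        fun y => rfl
      have : Fintype.card {p : Fin n × Fin n // p.1 ≠ p.2} ≤ n ^ 2 :=
        (Fintype.card_subtype_le _).trans (by simp [sq])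
      show Fintype.card {p : Fin n × Fin n // p.1 ≠ p.2} * 13 + 1 ≤ 13 * n ^ 2 + 1
      nlinarith

/-! ### The kernel circuit -/

/-- The size of the kernel circuit. [folklore] -/
def kernelSize (n k b r : ℕ) : ℕ :=
  (n + (k + 1) + (1 + n * (2 * k ^ 2 + 2))) * gadgetSize n k b r + n * (2 * n + 4) +
    (2 * k ^ 2 + 1) ^ 2 * (13 * n ^ 2 + 1) + n ^ 2

end Literature.Barriers.PneNP.Locality

end
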